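import Summits.BirchSwinnertonDyer.BirchSwinnertonDyer.Theorems.ManinLocalTwoThreeCDivisionCuspSeries
import HarnessLib

/-!
# The RATIONAL `q`-series of `℘_{Λ_W}(ℰ_f)` near the cusp for ANY elliptic `W/ℚ` (no minimality, no Honda)
(route `ManinLocalTwoThree`, crux C2 stmt-BirchSwinnertonDyer-22967; cell bsd-f2-manin, prover p3 gen 21; towards RATIONAL `Γ₁(N)`-presentations of
`x∘φ₁` on the Stevens curve — the input of the T-es-75 discharge road (LEAD p1: Galois action on translates; p2: cusp values) and of CES stage 3)

p3 gen 18's `CDivCuspGerm.exists_hasSum_qParam_sq_mul_x` gives, for a GLOBALLY MINIMAL `W`, an INTEGER series `P` with `Σ Pₘ𝕢ᵐ = 𝕢²·x_W(u_W(ℰ_f τ))`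
near `i∞` (Honda at the multiplier `1`).  Dropping Honda, the same germ computation gives a RATIONAL series for EVERY elliptic `W/ℚ` carrying an
`X₀(N)`-datum — in particular for the (non-minimal) short model of the Stevens curve `ℂ/Λ₁(f)` (`…StevensCurveDatum`):

* `exists_ratSeries_taylor_xGerm` — `Z := exp_W(Σ aₙqⁿ/n) = X·U`, `U ∈ 1 + qℚ⟦q⟧`, and `P := (X²x)_W(Z)·U⁻² ∈ ℚ⟦q⟧` with `P·U² = (X²x)_W(Z)`;
* `exists_hasSum_qParam_sq_mul_x_rat` — `∃ P ∈ ℚ⟦X⟧, B : Im τ > B ⟹ Σ Pₘ𝕢₁(τ)ᵐ = 𝕢₁(τ)²·(℘_{Λ_W}(ℰ_f τ) − b₂/12)`;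
* `exists_hasSum_qParam_sq_mul_twelve_weierstrassP_rat` — the same for `𝕢²·12℘_{Λ_W}(ℰ_f)`;
* `ratCuspSeries` — for `a ≥ 2`: `∃ g ∈ ℚ⟦X⟧, B : Im τ > B ⟹ Σ gₘ𝕢₁(τ)ᵐ = 12·℘_{Λ_W}(ℰ_f τ)·Δ(τ)^a` (the rational twin of (N7) `cDivCuspSeries`).

HONEST FRAMING: `q`-series bookkeeping (proofs adapted verbatim from `…CDivisionCuspGerm` / `…CDivisionCuspSeries`, `ℤ ↦ ℚ`, Honda removed); no named fact;
nothing about C2/C3, Manin's conjecture or BSD is proved here.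
[cite: SilvermanAEC2009, IV.1] [cite: Cox2013, §11.A Thm. 11.8]
-/

set_option autoImplicit false
-- lint-debt: the directory name repeats the summit name (sibling precedent `ManinLocalTwoThreeCDivisionCuspSeries.lean`)
set_option linter.dupNamespace false

noncomputable section

open scoped Topology PeriodPair MatrixGroups
open Complex Filter PowerSeries CongruenceSubgroup
open UpperHalfPlane hiding I
open WeierstrassCurve Literature.NumberTheory.EllipticCurves Literature.NumberTheory.EllipticCurves.ModularForms
open Summit.BirchSwinnertonDyer.Rank1Residual.ManinAdditive.CuspidalKummer
open Summit.BirchSwinnertonDyer.Rank1Residual.ManinAdditive.CuspidalKummerThree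
open Summit.BirchSwinnertonDyer.BirchSwinnertonDyer.Theorems.ManinLocalTwoThree.KummerCubeAnalytic
open Summit.BirchSwinnertonDyer.BirchSwinnertonDyer.Theorems.ManinLocalTwoThree.HalvingParam
open Summit.BirchSwinnertonDyer.BirchSwinnertonDyer.Theorems.ManinLocalTwoThree.CDivCuspGerm

namespace Summit.BirchSwinnertonDyer.BirchSwinnertonDyer.Theorems.ManinLocalTwoThree.StevensCurve

/-! ## §1 The rational Taylor series of `𝕢²·x_W(H)` -/

/-- **The rational series of `𝕢²·x_W(H)`** (no Honda): `Z := exp_W(Σ aₙqⁿ/n) = X·U` with `U ∈ 1 + qℚ⟦q⟧` (`a₁ = 1`), and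
`P := (X²x)_W(Z)·U⁻² ∈ ℚ⟦q⟧` satisfies `P·U² = (X²x)_W(Z)`. [cite: SilvermanAEC2009, IV.1] -/
theorem exists_ratSeries_taylor_xGerm (W : WeierstrassCurve ℚ) [W.IsElliptic] {N : ℕ} [NeZero N]
    (D : ModularParametrizationData W N) (a : ℕ → ℤ) (ha : ∀ n, (a n : ℂ) = cuspCoeff D.f n) :
    ∃ (P U : ℚ⟦X⟧), constantCoeff U = 1 ∧ W.formalExp.subst (lSeriesLog a) = X * U ∧
      P * U ^ 2 = W.formalXMulSq.subst (W.formalExp.subst (lSeriesLog a)) := by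
  set Z : ℚ⟦X⟧ := W.formalExp.subst (lSeriesLog a) with hZ
  have hf1 : cuspCoeff D.f 1 = 1 := D.isNewformOf.1.2.2
  have ha1 : a 1 = 1 := by
    have h := ha 1
    rw [hf1] at h
    exact_mod_cast h
  have hL0 : constantCoeff (lSeriesLog a) = 0 := by
    rw [← coeff_zero_eq_constantCoeff_apply, lSeriesLog, coeff_mk]
    simp
  have hZ0 : constantCoeff Z = 0 := PowerSeries.constantCoeff_subst_eq_zero hL0 _ W.constantCoeff_formalExp
  have hE1 : coeff 1 W.formalExp = 1 := by
    have h := congrArg (coeff 1) W.formalLog_subst_formalExp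
    rwa [coeff_one_subst_eq_mul _ W.constantCoeff_formalExp, coeff_one_formalLog, one_mul, coeff_one_X] at h
  have hZ1 : coeff 1 Z = 1 := by
    rw [hZ, coeff_one_subst_eq_mul _ hL0, hE1, one_mul, lSeriesLog, coeff_mk, ha1]
    simp
  -- `Z = X·U`
  set U : ℚ⟦X⟧ := PowerSeries.mk fun p ↦ coeff (p + 1) Z with hU
  have hZU : Z = X * U := by
    have h := PowerSeries.eq_X_mul_shift_add_const Z
    rw [hZ0, map_zero, add_zero] at h
    exact h
  have hU1 : constantCoeff U = 1 := by
    rw [← coeff_zero_eq_constantCoeff_apply, hU, coeff_mk, zero_add, hZ1]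
  -- the unit `U` and its inverse
  have hUu : constantCoeff U = ((1 : ℚˣ) : ℚ) := by rw [hU1, Units.val_one]
  have hUinv : U * PowerSeries.invOfUnit U 1 = 1 := PowerSeries.mul_invOfUnit U 1 hUu
  refine ⟨W.formalXMulSq.subst Z * PowerSeries.invOfUnit U 1 ^ 2, U, hU1, hZU, ?_⟩
  rw [mul_assoc, ← mul_pow, mul_comm (PowerSeries.invOfUnit U 1), hUinv, one_pow, mul_one]

/-! ## §2 `𝕢²·x_W(H)` is a rational `q`-series near `i∞` -/

/-- **`𝕢₁(τ)²·x_W(u_W(ℰ_f τ))` is a RATIONAL `q`-series near the cusp**, for every elliptic `W/ℚ` with an `X₀(N)`-datum `D` (any Manin constant;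
`x_W(u_W z) = ℘_{Λ_W}(z) − b₂/12`): the germ `(t²x)∘ε` divided by the unit `(t/q)²` (p3 gen 18's proof with Honda removed).
[cite: SilvermanAEC2009, IV.1] -/
theorem exists_hasSum_qParam_sq_mul_x_rat (W : WeierstrassCurve ℚ) [W.IsElliptic] {N : ℕ} [NeZero N]
    (D : ModularParametrizationData W N) :
    ∃ (P : ℚ⟦X⟧) (B : ℝ), ∀ τ : ℍ, B < τ.im →
      HasSum (fun m : ℕ ↦ ((coeff m P : ℚ) : ℂ) * Function.Periodic.qParam 1 (τ : ℂ) ^ m)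
        (Function.Periodic.qParam 1 (τ : ℂ) ^ 2 * (℘[D.L] (eichlerIntegral D.f τ) - (W.b₂ : ℂ) / 12)) := by
  classical
  set V := W.baseChange ℂ with hV
  set a : ℕ → ℤ := fun n ↦ W.LFunction n with hadef
  have ha : ∀ n, (a n : ℂ) = cuspCoeff D.f n := fun n ↦ by rw [D.isNewformOf.2 n]
  have hf1 : cuspCoeff D.f 1 = 1 := D.isNewformOf.1.2.2
  -- the two germs
  obtain ⟨G, hGan, hG0, hTG, hGval⟩ := exists_qGerm_locG W D a ha
  obtain ⟨Z, hZan, hZ0, hTZ, hZval⟩ := exists_qGerm_locT_intMul W D a ha 1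
  obtain ⟨P, U, hU1, hZU, hPU⟩ := exists_ratSeries_taylor_xGerm W D a ha
  simp only [Int.cast_one, one_smul] at hTZ
  -- `Z = q·Uf`, `Uf := dslope Z 0` analytic with `Uf 0 = 1`
  set Uf : ℂ → ℂ := dslope Z 0 with hUf
  have hZq : ∀ q, Z q = q * Uf q := fun q ↦ by
    have h := sub_smul_dslope Z 0 q
    rw [sub_zero, hZ0, sub_zero, smul_eq_mul] at h
    exact h.symm
  have hUfan : AnalyticAt ℂ Uf 0 := by
    obtain ⟨p, hp⟩ := hZan
    exact ⟨_, hp.has_fpower_series_dslope_fslope⟩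
  have hTUmap : taylorAt0 Uf = U.map (algebraMap ℚ ℂ) := by
    have h1 : taylorAt0 Z = X * taylorAt0 Uf := by
      have hfun : Z = (fun q : ℂ ↦ q) * Uf := by funext q; rw [Pi.mul_apply]; exact hZq q
      have hid : AnalyticAt ℂ (fun q : ℂ ↦ q) 0 := analyticAt_id
      have h := congrArg taylorAt0 hfun
      simp only [taylorAt0] at h ⊢
      rw [Literature.NumberTheory.Transcendental.AndreCriterion.taylor_mul hid hUfan] at h
      rw [h]
      congr 1
      exact taylorAt0_id
    have h2 : taylorAt0 Z = X * U.map (algebraMap ℚ ℂ) := by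
      rw [hTZ, hZU, map_mul, map_X]
    exact mul_left_cancel₀ X_ne_zero (h1.symm.trans h2)
  have hUf0 : Uf 0 = 1 := by
    have h := constantCoeff_taylorAt0 Uf
    rw [hTUmap, ← coeff_zero_eq_constantCoeff_apply, coeff_map, coeff_zero_eq_constantCoeff_apply, hU1] at h
    simpa using h.symm
  -- the germ `Xq := G/Uf²`
  set Xq : ℂ → ℂ := fun q ↦ G q / Uf q ^ 2 with hXq
  have hXqan : AnalyticAt ℂ Xq 0 := hGan.div (hUfan.pow 2) (by rw [hUf0]; norm_num)
  have hTXq : taylorAt0 Xq = P.map (algebraMap ℚ ℂ) := by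
    have hprod : taylorAt0 Xq * taylorAt0 Uf ^ 2 = taylorAt0 G := by
      have hUfne : ∀ᶠ q in 𝓝 (0 : ℂ), Uf q ≠ 0 := hUfan.continuousAt.eventually_ne (by rw [hUf0]; exact one_ne_zero)
      have hfun : G =ᶠ[𝓝 0] Xq * Uf ^ 2 := by
        filter_upwards [hUfne] with q hq
        rw [Pi.mul_apply, Pi.pow_apply, hXq]
        field_simp
      have h := Literature.NumberTheory.Transcendental.AndreCriterion.taylor_congr hfun
      simp only [taylorAt0] at h ⊢
      rw [Literature.NumberTheory.Transcendental.AndreCriterion.taylor_mul hXqan (hUfan.pow 2),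
        Literature.NumberTheory.Transcendental.AndreCriterion.taylor_pow hUfan 2] at h
      exact h.symm
    rw [hTUmap, hTG, ← hPU, map_mul, map_pow] at hprod
    have hUne : (U.map (algebraMap ℚ ℂ)) ^ 2 ≠ 0 := by
      refine pow_ne_zero 2 fun h0 ↦ ?_
      have h := congrArg constantCoeff h0
      rw [← coeff_zero_eq_constantCoeff_apply, coeff_map, coeff_zero_eq_constantCoeff_apply, hU1, map_zero] at h
      simp at h
    exact mul_right_cancel₀ hUne hprod
  -- near `q = 0`
  obtain ⟨r, hr, hsum⟩ := exists_hasSum_taylorAt0 hXqan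
  have hUfne' : ∀ᶠ q in 𝓝 (0 : ℂ), Uf q ≠ 0 := hUfan.continuousAt.eventually_ne (by rw [hUf0]; exact one_ne_zero)
  have hev : ∀ᶠ q in 𝓝[≠] (0 : ℂ), HasSum (fun m : ℕ ↦ coeff m (taylorAt0 Xq) * q ^ m) (Xq q) ∧ Uf q ≠ 0 ∧
      qGerm D.f q ∉ D.L.lattice := by
    have h1 : ∀ᶠ q in 𝓝 (0 : ℂ), ‖q‖ < r := by
      have : Metric.ball (0 : ℂ) r ∈ 𝓝 (0 : ℂ) := Metric.ball_mem_nhds 0 hr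
      filter_upwards [this] with q hq
      rwa [Metric.mem_ball, dist_zero_right] at hq
    filter_upwards [(h1.and hUfne').filter_mono nhdsWithin_le_nhds, eventually_qGerm_notMem D.f hf1 D.L] with q hq hqΛ
    exact ⟨hsum q hq.1, hq.2, hqΛ⟩
  obtain ⟨B, hB⟩ := exists_im_bound_of_eventually hev
  refine ⟨P, B, fun τ hτ ↦ ?_⟩
  obtain ⟨hS, hUq, hΛ⟩ := hB τ hτ
  set q := Function.Periodic.qParam 1 (τ : ℂ) with hq
  have hEq : qGerm D.f q = eichlerIntegral D.f τ := qGerm_apply D.f τ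
  rw [hEq] at hΛ
  -- `q²·x = G/Uf²`
  have hZval' : Z q = locT D.L V (eichlerIntegral D.f τ) := by simpa [hq] using hZval τ
  have hval : Xq q = q ^ 2 * (℘[D.L] (eichlerIntegral D.f τ) - (W.b₂ : ℂ) / 12) := by
    have hG := hGval τ
    rw [← hq, locG, if_neg hΛ, ← hZval'] at hG
    have hb₂ : V.b₂ = (W.b₂ : ℂ) := by rw [hV, WeierstrassCurve.baseChange, WeierstrassCurve.map_b₂]; rfl
    have hUq' : Uf q ≠ 0 := hUq
    rw [hXq]
    simp only
    rw [hG, hZq q, hb₂]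
    field_simp
  rw [← hval]
  rw [hTXq] at hS
  convert hS using 2 with m
  rw [coeff_map]
  simp

/-- **`𝕢₁(τ)²·12℘_{Λ_W}(ℰ_f τ)` is a rational `q`-series near the cusp** (`b₂ ∈ ℚ`). [cite: SilvermanAEC2009, IV.1] -/
theorem exists_hasSum_qParam_sq_mul_twelve_weierstrassP_rat (W : WeierstrassCurve ℚ) [W.IsElliptic] {N : ℕ} [NeZero N]
    (D : ModularParametrizationData W N) :
    ∃ (P : ℚ⟦X⟧) (B : ℝ), ∀ τ : ℍ, B < τ.im →
      HasSum (fun m : ℕ ↦ ((coeff m P : ℚ) : ℂ) * Function.Periodic.qParam 1 (τ : ℂ) ^ m)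
        (Function.Periodic.qParam 1 (τ : ℂ) ^ 2 * (12 * ℘[D.L] (eichlerIntegral D.f τ))) := by
  classical
  obtain ⟨P, B, hP⟩ := exists_hasSum_qParam_sq_mul_x_rat W D
  refine ⟨C (12 : ℚ) * P + C W.b₂ * X ^ 2, B, fun τ hτ ↦ ?_⟩
  have h1 := (hP τ hτ).mul_left (12 : ℂ)
  have h2 : HasSum (fun m : ℕ ↦ ((coeff m (C W.b₂ * X ^ 2 : ℚ⟦X⟧) : ℚ) : ℂ) * Function.Periodic.qParam 1 (τ : ℂ) ^ m)
      ((W.b₂ : ℂ) * Function.Periodic.qParam 1 (τ : ℂ) ^ 2) := by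
    have h : HasSum (fun m : ℕ ↦ if m = 2 then (W.b₂ : ℂ) * Function.Periodic.qParam 1 (τ : ℂ) ^ 2 else 0)
        ((W.b₂ : ℂ) * Function.Periodic.qParam 1 (τ : ℂ) ^ 2) := hasSum_ite_eq 2 _
    convert h using 2 with m
    rw [coeff_C_mul, coeff_X_pow]
    split_ifs with hm
    · rw [hm]; push_cast; ring
    · simp
  have h := h1.add h2
  have hfun : (fun m : ℕ ↦ ((coeff m (C (12 : ℚ) * P + C W.b₂ * X ^ 2) : ℚ) : ℂ) * Function.Periodic.qParam 1 (τ : ℂ) ^ m) =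
      fun m : ℕ ↦ 12 * (((coeff m P : ℚ) : ℂ) * Function.Periodic.qParam 1 (τ : ℂ) ^ m) +
        ((coeff m (C W.b₂ * X ^ 2 : ℚ⟦X⟧) : ℚ) : ℂ) * Function.Periodic.qParam 1 (τ : ℂ) ^ m := by
    funext m
    rw [map_add, coeff_C_mul]
    push_cast
    ring
  have hval : Function.Periodic.qParam 1 (τ : ℂ) ^ 2 * (12 * ℘[D.L] (eichlerIntegral D.f τ)) =
      12 * (Function.Periodic.qParam 1 (τ : ℂ) ^ 2 * (℘[D.L] (eichlerIntegral D.f τ) - (W.b₂ : ℂ) / 12)) +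
        (W.b₂ : ℂ) * Function.Periodic.qParam 1 (τ : ℂ) ^ 2 := by
    ring
  rw [hfun, hval]
  exact h

/-! ## §3 `12·℘_{Λ_W}(ℰ_f)·Δ^a` is a rational `q`-series near `i∞` -/

/-- Shift for complex series: `Σ (Xᵏ·R)ₘ qᵐ = S`, `q ≠ 0` ⟹ `Σ Rₘ qᵐ = S/qᵏ`. [folklore] -/
theorem hasSum_coeff_of_X_pow_mul {R : ℂ⟦X⟧} {q S : ℂ} (hq : q ≠ 0) (k : ℕ)
    (h : HasSum (fun m : ℕ ↦ coeff m (X ^ k * R) * q ^ m) S) :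
    HasSum (fun m : ℕ ↦ coeff m R * q ^ m) (S / q ^ k) := by
  have h1 := (hasSum_nat_add_iff' k).mpr h
  have hzero : ∑ i ∈ Finset.range k, coeff i (X ^ k * R) * q ^ i = 0 := by
    refine Finset.sum_eq_zero fun i hi ↦ ?_
    rw [Finset.mem_range] at hi
    rw [PowerSeries.coeff_X_pow_mul', if_neg (not_le.mpr hi), zero_mul]
  rw [hzero, sub_zero] at h1
  have hfun : (fun m : ℕ ↦ coeff (m + k) (X ^ k * R) * q ^ (m + k)) =
      fun m : ℕ ↦ q ^ k * (coeff m R * q ^ m) := by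
    funext m
    rw [PowerSeries.coeff_X_pow_mul', if_pos (Nat.le_add_left k m), Nat.add_sub_cancel, pow_add]
    ring
  rw [hfun] at h1
  have h2 := h1.mul_left (q ^ k)⁻¹
  have hqk : q ^ k ≠ 0 := pow_ne_zero k hq
  simp only [← mul_assoc, inv_mul_cancel₀ hqk, one_mul] at h2
  rwa [div_eq_inv_mul]

/-- **The rational cusp series of `12·℘_{Λ_W}(ℰ_f)·Δ^a`** (rational twin of (N7) `CDivCuspGerm.cDivCuspSeries`): for every elliptic `W/ℚ` with an
`X₀(N)`-datum `D` and every `a ≥ 2` there are `g ∈ ℚ⟦X⟧` and `B` with `Σ gₘ𝕢₁(τ)ᵐ = 12·℘_{Λ_W}(ℰ_f τ)·Δ(τ)^a` for `Im τ > B`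
(`g = P'·X^{a−2}·𝔡^a`, `Δ = q∏(1−qⁿ)²⁴`). [cite: SilvermanAEC2009, IV.1] [cite: Cox2013, §11.A Thm. 11.8] -/
theorem ratCuspSeries (W : WeierstrassCurve ℚ) [W.IsElliptic] {N : ℕ} [NeZero N]
    (D : ModularParametrizationData W N) (a : ℕ) (ha : 2 ≤ a) :
    ∃ (g : ℚ⟦X⟧) (B : ℝ), ∀ τ : ℍ, B < τ.im →
      HasSum (fun n : ℕ ↦ ((coeff n g : ℚ) : ℂ) * Function.Periodic.qParam 1 (τ : ℂ) ^ n)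
        ((12 : ℂ) * ℘[D.L] (eichlerIntegral D.f τ) * ModularForm.discriminant τ ^ a) := by
  classical
  obtain ⟨P, B, hP⟩ := exists_hasSum_qParam_sq_mul_twelve_weierstrassP_rat W D
  set R : ℤ⟦X⟧ := X ^ (a - 2) * formalDeltaUnit ^ a with hR
  refine ⟨P * R.map (Int.castRingHom ℚ), B, fun τ hτ ↦ ?_⟩
  set q := Function.Periodic.qParam 1 (τ : ℂ) with hq
  have hq0 : q ≠ 0 := Function.Periodic.qParam_ne_zero _
  -- `Δ^a = Σ ((X𝔡)^a)ₘ qᵐ = Σ (X²·R)ₘ qᵐ`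
  have hΔ : HasSum (fun m : ℕ ↦ ((coeff m (X * formalDeltaUnit) : ℤ) : ℂ) * q ^ m) (ModularForm.discriminant τ) :=
    Literature.NumberTheory.EllipticCurves.hasSum_X_mul_formalDeltaUnit τ
  have hΔa := hasSum_intCoeff_pow hΔ a
  have hXR : (X * formalDeltaUnit : ℤ⟦X⟧) ^ a = X ^ 2 * R := by
    rw [hR, mul_pow, ← mul_assoc, ← pow_add, Nat.add_sub_cancel' ha]
  rw [hXR] at hΔa
  have hRsum := hasSum_intCoeff_of_X_pow_mul hq0 2 hΔa
  -- as complex series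
  have hP' : HasSum (fun m : ℕ ↦ coeff m (P.map (algebraMap ℚ ℂ)) * q ^ m) (q ^ 2 * (12 * ℘[D.L] (eichlerIntegral D.f τ))) := by
    convert hP τ hτ using 2 with m
    rw [coeff_map]
    simp [hq]
  have hR' : HasSum (fun m : ℕ ↦ coeff m ((R.map (Int.castRingHom ℚ)).map (algebraMap ℚ ℂ)) * q ^ m)
      (ModularForm.discriminant τ ^ a / q ^ 2) := by
    convert hRsum using 2 with m
    rw [coeff_map, coeff_map]
    simp
  have hprod := KummerCubeSigmaLeaves.hasSum_coeff_mul_pow_mul hP' hR'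
  have hval : q ^ 2 * (12 * ℘[D.L] (eichlerIntegral D.f τ)) * (ModularForm.discriminant τ ^ a / q ^ 2) =
      (12 : ℂ) * ℘[D.L] (eichlerIntegral D.f τ) * ModularForm.discriminant τ ^ a := by
    field_simp
  rw [hval, ← map_mul] at hprod
  convert hprod using 2 with n
  rw [coeff_map, hq]
  simp

end Summit.BirchSwinnertonDyer.BirchSwinnertonDyer.Theorems.ManinLocalTwoThree.StevensCurve

end
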